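import Mathlib
import Summits.NavierStokesRegularity.NavierStokesRegularity.Theorems.ScenarioCensusHelicalSlabFlux
import Literature.Analysis.FluidPDE.PineauVicolAngularMean
import HarnessLib

/-!
# Census row S7 (b): flows whose radial velocity is axisymmetric have mean-free radial velocity
# on vertical periods

Support file for the scenario census of `NavierStokesRegularity` (cell `pub/ns-census`, block S,
row S7 = Bang–Gui–Wang–Xie, J. Fluid Mech. 1005 (2025) A6 = arXiv:2205.13259, Thm 1.4; tree FACT
`Literature.Analysis.FluidPDE.BangGuiWangXie2025_periodicSlab_liouville`). Case (b) of the printed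
theorem ("`u^r` is independent of `θ`"), §6 Step 2: "Using the divergence free property of `u`,
one has `∂_r ∫₀¹∫₀^{2π} r u^r dθ dz = 0` … Since `u^r` is independent of `θ`, it holds that
`∫₀¹ r u^r dz = (2π)⁻¹ ∫₀¹∫₀^{2π} r u^r dθ dz = 0`." In Cartesian vocabulary:

* `inner_horizPart_eq_zero_of_isAxisymmetric_of_divergence_eq_zero` — the flux core shared with
  rows S6 / S7(a): a differentiable AXISYMMETRIC field `g` with `div g = 0` and `∂₃g = 0` has no
  radial part, `⟪x_h, g x⟫ = 0`;
* `radial_verticalMean_eq_zero_of_radialVelocity_axisymmetric` — for `U ∈ C¹` with bounded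
  derivative, divergence free, axially `L`-periodic, with `radialVelocity U = u^r` an axisymmetric
  scalar: `∫₀ᴸ ⟪x_h, U(x + s e₃)⟫ ds = 0` for every `x` (apply the core to the ANGULAR MEAN
  `⟨g⟩_θ` of the vertical period integral `g`, `Literature.Analysis.FluidPDE.angularMeanVec`:
  it is axisymmetric, `C¹`, divergence free and `z`-independent, and its radial part is that of
  `g` because `⟪x_h, g⟫` is rotation-invariant);

No summit statement and no census row is proved in this file.

## References

* J. Bang, C. Gui, Y. Wang, C. Xie, arXiv:2205.13259, §6 (proof of Thm 1.4, Step 2).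
  [BangGuiWangXie2025]
* E. Pineau, V. Vicol (2026), §6.1 (6.4) (the angular mean of a vector field; tree
  `PineauVicolAngularMean`). [PineauVicol2026]
-/

-- the summit and its single problem share the name (D-0017 nested layout)
set_option linter.dupNamespace false

noncomputable section

open MeasureTheory Set Function Filter
open scoped Topology InnerProductSpace RealInnerProductSpace

namespace Summit.NavierStokesRegularity.NavierStokesRegularity.Theorems.ScenarioCensus.PeriodicSlab

open Literature.Analysis Literature.Analysis.FluidPDE
open Summit.NavierStokesRegularity.NavierStokesRegularity.Theorems.ScenarioCensus.HelicalSlab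

/-! ### The flux core: axisymmetric, divergence-free, `z`-independent fields have no radial part -/

/-- **Axisymmetric divergence-free fields with `∂₃g = 0` have no radial part.** For a
differentiable `g : ℝ³ → ℝ³` with `div g = 0`, `Dg(x) e₃ = 0` and `g(R_θ x) = R_θ g(x)`:
`⟪x_h, g x⟫ = 0` for all `x`. (Infinitesimal axisymmetry `Dg(x)[Jx] = J g(x)` and the trace
identity give `⟪Dg x_h, x_h⟫ + ⟪x_h, g⟫ = 0`, so `⟪x_h, g⟫` is constant along horizontal rays and
vanishes on the axis.) -/
theorem inner_horizPart_eq_zero_of_isAxisymmetric_of_divergence_eq_zero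
    {g : EuclideanSpace ℝ (Fin 3) → EuclideanSpace ℝ (Fin 3)} (hgd : Differentiable ℝ g)
    (hdiv : ∀ y, VectorCalculus.divergence g y = 0) (hz : ∀ y, fderiv ℝ g y eZ = 0)
    (hax : IsAxisymmetric g) (x : EuclideanSpace ℝ (Fin 3)) : ⟪horizPart x, g x⟫ = 0 := by
  have hDg_rot : ∀ y, fderiv ℝ g y (rotGen y) = rotGen (g y) := fun y => hax.fderiv_rotGen (hgd y)
  set b := EuclideanSpace.basisFun (Fin 3) ℝ with hb
  -- the key identity `⟪Dg(y) y_h, y_h⟫ + ⟪y_h, g y⟫ = 0`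
  have key : ∀ y : EuclideanSpace ℝ (Fin 3),
      ⟪fderiv ℝ g y (horizPart y), horizPart y⟫ + ⟪horizPart y, g y⟫ = 0 := by
    intro y
    set G := fderiv ℝ g y with hG
    have hb0 : b 0 = EuclideanSpace.single 0 (1 : ℝ) := by simp [hb]
    have hb1 : b 1 = EuclideanSpace.single 1 (1 : ℝ) := by simp [hb]
    have hb2 : b 2 = EuclideanSpace.single 2 (1 : ℝ) := by simp [hb]
    have htr : ⟪b 0, G (b 0)⟫ + ⟪b 1, G (b 1)⟫ + ⟪b 2, G (b 2)⟫ = 0 := by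
      have h := divergence_eq_sum_inner_fderiv b g y
      rw [hdiv y, Fin.sum_univ_three] at h
      rw [hG]; linarith
    have htr' : G (b 0) 0 + G (b 1) 1 + G (b 2) 2 = 0 := by
      have h := htr
      rw [hb0, hb1, hb2] at h ⊢
      simpa [EuclideanSpace.inner_single_left] using h
    have hcol : G (b 2) = 0 := by rw [hb2, hG]; exact hz y
    have hG22 : G (b 2) 2 = 0 := by rw [hcol]; rfl
    have hrot := hDg_rot y
    rw [← hG, rotGen_eq_sub_single, map_sub, map_smul, map_smul, ← hb0, ← hb1] at hrot
    have hr0 := congrArg (fun w : EuclideanSpace ℝ (Fin 3) => w 0) hrot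
    have hr1 := congrArg (fun w : EuclideanSpace ℝ (Fin 3) => w 1) hrot
    simp only [PiLp.sub_apply, PiLp.smul_apply, smul_eq_mul, rotGen_apply_zero, rotGen_apply_one] at hr0 hr1
    have hhp : horizPart y = y 0 • b 0 + y 1 • b 1 := by
      rw [horizPart_eq_toLp, hb0, hb1]; ext i; fin_cases i <;> simp
    have e1 : ⟪G (horizPart y), horizPart y⟫ =
        y 0 * (y 0 * G (b 0) 0 + y 1 * G (b 1) 0) + y 1 * (y 0 * G (b 0) 1 + y 1 * G (b 1) 1) := by
      rw [real_inner_comm, inner_horizPart_left, hhp, map_add, map_smul, map_smul]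
      simp only [PiLp.add_apply, PiLp.smul_apply, smul_eq_mul]
    have e2 : ⟪horizPart y, g y⟫ = y 0 * g y 0 + y 1 * g y 1 := inner_horizPart_left y (g y)
    rw [e1, e2]
    linear_combination (y 0 ^ 2 + y 1 ^ 2) * htr' - (y 0 ^ 2 + y 1 ^ 2) * hG22 +
      y 1 * hr0 - y 0 * hr1
  -- the flux function along the horizontal ray through `x`
  set h : EuclideanSpace ℝ (Fin 3) → ℝ := fun y => ⟪horizPart y, g y⟫ with hh
  have hhd : ∀ y, HasFDerivAt h ((innerSL ℝ (horizPart y)).comp (fderiv ℝ g y) +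
      (innerSL ℝ (g y)).comp horizPart) y := by
    intro y
    refine ((horizPart.hasFDerivAt (x := y)).inner ℝ (hgd y).hasFDerivAt).congr_fderiv ?_
    ext v
    simp only [_root_.add_apply, ContinuousLinearMap.comp_apply, innerSL_apply_apply,
      fderivInnerCLM_apply, ContinuousLinearMap.prod_apply]
    rw [real_inner_comm (g y)]
  have hhD : ∀ y v, fderiv ℝ h y v = ⟪horizPart y, fderiv ℝ g y v⟫ + ⟪g y, horizPart v⟫ := by
    intro y v
    rw [(hhd y).fderiv]
    simp only [_root_.add_apply, ContinuousLinearMap.comp_apply, innerSL_apply_apply]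
  set c : EuclideanSpace ℝ (Fin 3) := (x 2) • eZ with hc
  have hc0 : horizPart c = 0 := by rw [hc, map_smul, horizPart_eZ, smul_zero]
  have hray : ∀ t : ℝ, horizPart (c + t • horizPart x) = t • horizPart x := by
    intro t; rw [map_add, hc0, zero_add, map_smul, horizPart_horizPart]
  set ψ : ℝ → ℝ := fun t => h (c + t • horizPart x) with hψ
  have hψd : ∀ t, HasDerivAt ψ (fderiv ℝ h (c + t • horizPart x) (horizPart x)) t := by
    intro t
    have hl : HasDerivAt (fun τ : ℝ => c + τ • horizPart x) (horizPart x) t := by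
      have := ((hasDerivAt_id t).smul_const (horizPart x)).const_add c
      simpa using this
    exact ((hhd _).comp_hasDerivAt t hl).congr_deriv (by rw [(hhd _).fderiv])
  have hψ0 : ∀ t : ℝ, t ≠ 0 → fderiv ℝ h (c + t • horizPart x) (horizPart x) = 0 := by
    intro t ht
    set y := c + t • horizPart x with hy
    have hyh : horizPart y = t • horizPart x := hray t
    have hk := key y
    rw [hyh] at hk
    simp only [map_smul, real_inner_smul_left, real_inner_smul_right] at hk
    have e3 : ⟪horizPart x, fderiv ℝ g y (horizPart x)⟫ = ⟪fderiv ℝ g y (horizPart x), horizPart x⟫ :=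
      real_inner_comm _ _
    have e4 : ⟪g y, horizPart x⟫ = ⟪horizPart x, g y⟫ := real_inner_comm _ _
    rw [hhD, hyh, real_inner_smul_left, horizPart_horizPart, e3, e4]
    have h0 : t * (t * ⟪fderiv ℝ g y (horizPart x), horizPart x⟫ + ⟪horizPart x, g y⟫) = 0 := by
      linear_combination hk
    rcases mul_eq_zero.1 h0 with h1 | h1
    · exact absurd h1 ht
    · exact h1
  have hψcont : ContinuousOn ψ (Icc 0 1) := fun t _ => (hψd t).continuousAt.continuousWithinAt
  have hψdiff : DifferentiableOn ℝ ψ (Ioo 0 1) := fun t _ => (hψd t).differentiableAt.differentiableWithinAt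
  obtain ⟨t₀, ht₀, hslope⟩ := exists_deriv_eq_slope ψ zero_lt_one hψcont hψdiff
  rw [(hψd t₀).deriv, hψ0 t₀ (ne_of_gt ht₀.1)] at hslope
  have hψ01 : ψ 1 = ψ 0 := by
    have : (ψ 1 - ψ 0) / (1 - 0) = 0 := hslope.symm
    rw [sub_zero, div_one] at this
    linarith
  have hψ0' : ψ 0 = 0 := by
    simp only [hψ, zero_smul, add_zero, hh, hc0, inner_zero_left]
  have hψ1 : ψ 1 = ⟪horizPart x, g x⟫ := by
    have hxc : c + (1 : ℝ) • horizPart x = x := by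
      rw [one_smul, hc, add_comm]; exact horizPart_add_apply_two_smul_eZ x
    simp only [hψ, hh, hxc]
  rw [← hψ1, hψ01, hψ0']

/-! ### The radial velocity and the angular mean -/

/-- `⟪x_h, V x⟫ = r u^r(x)` (`r u^r` in junk-free polynomial form). -/
theorem inner_horizPart_eq_cylRadius_mul_radialVelocity
    (V : EuclideanSpace ℝ (Fin 3) → EuclideanSpace ℝ (Fin 3)) (x : EuclideanSpace ℝ (Fin 3)) :
    ⟪horizPart x, V x⟫ = cylRadius x * radialVelocity V x := by
  rw [radialVelocity, horizPart_eq_cylRadius_smul_eR, real_inner_smul_left, real_inner_comm]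

/-- If `⟪x_h, V⟫` is rotation-invariant then so is the radial velocity `u^r = ⟪V, e_r⟫`. -/
theorem isAxisymmetricScalar_radialVelocity_of_inner_horizPart
    {V : EuclideanSpace ℝ (Fin 3) → EuclideanSpace ℝ (Fin 3)}
    (h : IsAxisymmetricScalar fun x => ⟪horizPart x, V x⟫) : IsAxisymmetricScalar (radialVelocity V) := by
  intro θ x
  have h1 := h θ x
  simp only [inner_horizPart_eq_cylRadius_mul_radialVelocity, cylRadius_rotZ] at h1
  by_cases hx : cylRadius x = 0
  · have hx' : cylRadius (rotZ θ x) = 0 := by rw [cylRadius_rotZ, hx]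
    simp only [radialVelocity, eR, hx, hx', inv_zero, zero_smul, inner_zero_right]
  · exact mul_left_cancel₀ hx h1

/-! ### The flux lemma under axisymmetry of the radial velocity -/

/-- **Flows with axisymmetric radial velocity have mean-free radial velocity on vertical
periods** (Bang–Gui–Wang–Xie, §6 Step 2, Cartesian form). Let `U ∈ C¹(ℝ³; ℝ³)` have bounded
derivative, be divergence free and axially `L`-periodic, and let `radialVelocity U = u^r` be an
axisymmetric scalar. Then `∫₀ᴸ ⟪x_h, U(x + s e₃)⟫ ds = 0` for every `x`. -/
theorem radial_verticalMean_eq_zero_of_radialVelocity_axisymmetric {L : ℝ}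
    {U : EuclideanSpace ℝ (Fin 3) → EuclideanSpace ℝ (Fin 3)} (hU : ContDiff ℝ 1 U) {K : ℝ}
    (hK : ∀ x, ‖fderiv ℝ U x‖ ≤ K) (hdiv : VectorCalculus.IsDivFree U)
    (hper : IsAxiallyPeriodic L U) (hrad : IsAxisymmetricScalar (radialVelocity U))
    (x : EuclideanSpace ℝ (Fin 3)) :
    ∫ s in (0 : ℝ)..L, ⟪horizPart x, U (x + s • eZ)⟫ = 0 := by
  have hUc : Continuous U := hU.continuous
  have hDUc : Continuous (fderiv ℝ U) := hU.continuous_fderiv one_ne_zero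
  have hline : ∀ y : EuclideanSpace ℝ (Fin 3), Continuous fun s : ℝ => y + s • (eZ : EuclideanSpace ℝ (Fin 3)) :=
    fun y => continuous_const.add (continuous_id.smul continuous_const)
  -- the vertical period integral `g`, `C¹`, divergence free, `z`-independent
  set g : EuclideanSpace ℝ (Fin 3) → EuclideanSpace ℝ (Fin 3) := fun y => ∫ s in (0 : ℝ)..L, U (y + s • eZ)
    with hg
  set Dg : EuclideanSpace ℝ (Fin 3) → (EuclideanSpace ℝ (Fin 3) →L[ℝ] EuclideanSpace ℝ (Fin 3)) :=
    fun y => ∫ s in (0 : ℝ)..L, fderiv ℝ U (y + s • eZ) with hDg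
  have hgD : ∀ y, HasFDerivAt g (Dg y) y := fun y => hasFDerivAt_verticalIntegral hU hK y
  have hgd : Differentiable ℝ g := fun y => (hgD y).differentiableAt
  have hgF : ∀ y, fderiv ℝ g y = Dg y := fun y => (hgD y).fderiv
  have hgc : Continuous g := hgd.continuous
  have hDint : ∀ y, IntervalIntegrable (fun s : ℝ => fderiv ℝ U (y + s • eZ)) volume 0 L :=
    fun y => (hDUc.comp (hline y)).intervalIntegrable _ _
  have hDgc : Continuous Dg := by
    have h := intervalIntegral.continuous_parametric_intervalIntegral_of_continuous'
      (μ := volume) (f := fun (y : EuclideanSpace ℝ (Fin 3)) (s : ℝ) => fderiv ℝ U (y + s • eZ))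
      (by exact hDUc.comp (continuous_fst.add (continuous_snd.smul continuous_const))) 0 L
    exact h
  have hg1 : ContDiff ℝ 1 g := by
    rw [contDiff_one_iff_fderiv]
    refine ⟨hgd, ?_⟩
    rw [show fderiv ℝ g = Dg from funext hgF]
    exact hDgc
  have hgz : ∀ (y : EuclideanSpace ℝ (Fin 3)) (t : ℝ), g (y + t • eZ) = g y :=
    fun y t => verticalIntegral_add_smul_eZ hper y t
  set τ : (EuclideanSpace ℝ (Fin 3) →L[ℝ] EuclideanSpace ℝ (Fin 3)) →L[ℝ] ℝ :=
    LinearMap.toContinuousLinearMap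
      ((LinearMap.trace ℝ (EuclideanSpace ℝ (Fin 3))).comp (ContinuousLinearMap.coeLM ℝ)) with hτ
  have hτ_apply : ∀ T : EuclideanSpace ℝ (Fin 3) →L[ℝ] EuclideanSpace ℝ (Fin 3),
      τ T = LinearMap.trace ℝ _ (T : EuclideanSpace ℝ (Fin 3) →ₗ[ℝ] EuclideanSpace ℝ (Fin 3)) :=
    fun T => rfl
  have hdivg : ∀ y, VectorCalculus.divergence g y = 0 := fun y => by
    rw [VectorCalculus.divergence, hgF y, ← hτ_apply, hDg, ← τ.intervalIntegral_comp_comm (hDint y)]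
    have : (fun s : ℝ => τ (fderiv ℝ U (y + s • eZ))) = fun _ => (0 : ℝ) := by
      funext s
      rw [hτ_apply]
      exact hdiv (y + s • eZ)
    rw [this, intervalIntegral.integral_const, smul_zero]
  have hDg_eZ : ∀ y, fderiv ℝ g y eZ = 0 := fun y => by
    have h1 : HasDerivAt (fun t : ℝ => g (y + t • eZ)) (fderiv ℝ g (y + (0 : ℝ) • eZ) eZ) 0 :=
      hasDerivAt_comp_add_smul_eZ hgd y 0
    have h2 : (fun t : ℝ => g (y + t • eZ)) = fun _ => g y := funext fun t => hgz y t
    rw [h2, zero_smul, add_zero] at h1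
    exact h1.unique (hasDerivAt_const (0 : ℝ) (g y))
  -- `⟪x_h, g⟫` is rotation-invariant (here the hypothesis on `u^r` enters)
  have hurax : IsAxisymmetricScalar fun y => ⟪horizPart y, U y⟫ := fun θ y => by
    show ⟪horizPart (rotZ θ y), U (rotZ θ y)⟫ = ⟪horizPart y, U y⟫
    rw [inner_horizPart_eq_cylRadius_mul_radialVelocity, inner_horizPart_eq_cylRadius_mul_radialVelocity,
      cylRadius_rotZ, hrad θ y]
  have hrepr : ∀ y, ⟪horizPart y, g y⟫ = ∫ s in (0 : ℝ)..L, ⟪horizPart y, U (y + s • eZ)⟫ := by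
    intro y
    show innerSL ℝ (horizPart y) (∫ s in (0 : ℝ)..L, U (y + s • eZ)) = _
    have hint : IntervalIntegrable (fun s : ℝ => U (y + s • eZ)) volume 0 L :=
      (hUc.comp (hline y)).intervalIntegrable _ _
    rw [← (innerSL ℝ (horizPart y)).intervalIntegral_comp_comm hint]
    simp only [innerSL_apply_apply]
  have hhax : IsAxisymmetricScalar fun y => ⟪horizPart y, g y⟫ := fun θ y => by
    show ⟪horizPart (rotZ θ y), g (rotZ θ y)⟫ = ⟪horizPart y, g y⟫
    rw [hrepr, hrepr]
    refine intervalIntegral.integral_congr fun s _ => ?_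
    show ⟪horizPart (rotZ θ y), U (rotZ θ y + s • eZ)⟫ = ⟪horizPart y, U (y + s • eZ)⟫
    have e1 : horizPart (rotZ θ y) = horizPart (rotZ θ (y + s • eZ)) := by
      rw [rotZ_add_smul_eZ, horizPart_add_smul_eZ]
    have e2 : horizPart y = horizPart (y + s • eZ) := by rw [horizPart_add_smul_eZ]
    rw [← rotZ_add_smul_eZ, e1, e2]
    exact hurax θ (y + s • eZ)
  -- the angular mean `G = ⟨g⟩_θ`: axisymmetric, `C¹`, divergence free, `z`-independent
  set G : EuclideanSpace ℝ (Fin 3) → EuclideanSpace ℝ (Fin 3) := angularMeanVec g with hGdef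
  have hG1 : ContDiff ℝ 1 G := contDiff_angularMeanVec (n := 1) hg1
  have hGd : Differentiable ℝ G := hG1.differentiable one_ne_zero
  have hGax : IsAxisymmetric G := isAxisymmetric_angularMeanVec g
  have hdivG : ∀ y, VectorCalculus.divergence G y = 0 := fun y => by
    have h1 := congrFun (angularMean_divergence hg1) y
    rw [← h1, show VectorCalculus.divergence g = fun _ => (0 : ℝ) from funext hdivg, angularMean_apply,
      intervalIntegral.integral_const, smul_zero, smul_zero]
  have hrotZ_eZ : ∀ θ : ℝ, rotZ θ (eZ : EuclideanSpace ℝ (Fin 3)) = eZ := fun θ => by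
    ext i; fin_cases i <;> simp [rotZ, eZ]
  have hGz : ∀ y, fderiv ℝ G y eZ = 0 := fun y => by
    rw [hGdef, fderiv_angularMeanVec_apply hg1 y eZ]
    have : (fun θ : ℝ => rotZ (-θ) (fderiv ℝ g (rotZ θ y) (rotZ θ eZ))) = fun _ => 0 := by
      funext θ
      rw [hrotZ_eZ, hDg_eZ]
      ext i; fin_cases i <;> simp [rotZ]
    rw [this, intervalIntegral.integral_const, smul_zero, smul_zero]
  -- the core: `G` has no radial part
  have hGflux : ∀ y, ⟪horizPart y, G y⟫ = 0 :=
    inner_horizPart_eq_zero_of_isAxisymmetric_of_divergence_eq_zero hGd hdivG hGz hGax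
  -- the radial part of `G` is that of `g`
  have hradg : IsAxisymmetricScalar (radialVelocity g) :=
    isAxisymmetricScalar_radialVelocity_of_inner_horizPart hhax
  have hGg : ⟪horizPart x, G x⟫ = ⟪horizPart x, g x⟫ := by
    rw [inner_horizPart_eq_cylRadius_mul_radialVelocity, inner_horizPart_eq_cylRadius_mul_radialVelocity]
    congr 1
    rw [radialVelocity, hGdef, inner_angularMeanVec_eR hgc x, hradg.angularMean_eq]
  rw [← hrepr x, ← hGg]
  exact hGflux x

end Summit.NavierStokesRegularity.NavierStokesRegularity.Theorems.ScenarioCensus.PeriodicSlab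

end
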